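import Summits.QuantumFields.BalabanUV.Gaps.D1PinnedColourPolynomialAlgebra
import Summits.QuantumFields.BalabanUV.Gaps.D1PinnedColourLineReadings
import Summits.QuantumFields.BalabanUV.Gaps.D1PinnedResponseTowers
import Summits.QuantumFields.BalabanUV.Gaps.D1PinnedSecondOrderModular
import Summits.QuantumFields.BalabanUV.Gaps.D1PinnedSecondOrderUniversal
import Summits.QuantumFields.BalabanUV.Gaps.D1PinnedTableResponseUniversal
import Summits.QuantumFields.BalabanUV.Gaps.D1PinnedPositionTableAffine
import Summits.QuantumFields.BalabanUV.Gaps.D1PinnedColourResponseUniversal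

/-!
# D1 (pinned family) — THE COLOUR MAP IS ONE REAL POLYNOMIAL OF TOTAL DEGREE ≤ 4 WITHOUT LINEAR PART; (D1) on the whole pinned family is ONE polynomial equation `γ_r + Φ(c⃗) + cB·σ_r + Λ(Tc) = stepBal N Lc` (hypothesis-free at the pin)

Census row 81 of `HOME/g1/RESIDUE.md`, file 2 of 2 (the pinned half; the algebra is `Gaps/D1PinnedColourPolynomialAlgebra`).  For the β-lead's pinned family
`JsBalAn1(r; cE cVH cΛ; Lc^8; cB; Tc)` (`2 ≤ Lc`, any box root `r`, border weight `cB`, position table `Tc`, channel `(μ,ν)`), write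
`lim β⁰(r, c⃗; cB, Tc) := CauchyRate.lim (j ↦ secondMoment (TbalOf Lc (JsBalAn1 …) j) μ ν)` for the limit one-loop coefficient ((D1) there ⟺ `lim β⁰ = stepBal N Lc`,
`CapTailPinnedLimitSign.d1Drift_pinned_iff_lim_eq`).

CONTENT (all [folklore]; 0 def, 0 sorry; every ingredient a tree theorem BY NAME): **`lim_eq_eval_mvPolynomial`** — for every root, `cB`, `Tc`, channel there is ONE
`P : MvPolynomial (Fin 3) ℝ` with `P.totalDegree ≤ 4`, `P.homogeneousComponent 1 = 0`, `P.coeff 0 = lim β⁰(r,0⃗;cB,Tc)` and `lim β⁰(r,(cE,cVH,cΛ);cB,Tc) = MvPolynomial.eval ![cE,cVH,cΛ] P`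
for EVERY colour triple (tensor Lagrange from `D1PinnedColourLineReadings.lim_line_fiveMembers`, degree trimmed by `D1PinnedColourRayReadings.lim_ray_fourMembers`);
**`d1Drift_iff_eval_eq_stepBal`** ((D1) at `c⃗` ⟺ `P(c⃗) = stepBal N Lc`); **`d1Drift_allColours_or_properAlgebraic`** and **`d1Drift_allColours_or_interior_empty`** (fixed `(r; cB; Tc)`,
numeral, channel: EITHER (D1) holds at EVERY colour triple, OR the colour triples meeting (D1) form the real zero set of a NONZERO polynomial of total degree ≤ 4 — a CLOSED subset of
ℝ³ with EMPTY INTERIOR: (D1) at the pinned literal is then NOT an open condition on print's colour triple); **`lim_normalForm_polynomial`** ∕ **`d1Drift_iff_normalForm_polynomial`**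
(fixed root: `lim β⁰(r,c⃗;cB,Tc) = P_r(c⃗) + cB·σ_r + Λ_r(Tc)` with `Λ_r` an `ℝ`-linear functional of the table); **`lim_normalForm_universal`** ∕ **`lim_normalForm_targets`** ∕ **`d1Drift_iff_normalForm_universal`** ∕ `d1Drift_ctr_iff_normalForm`
(ALL roots: ONE quartic `Φ ∈ ℝ[X₀,X₁,X₂]` — `totalDegree ≤ 4`, no constant, no linear part — and ONE `ℝ`-linear `Λ`, BOTH ROOT-FREE, and two reals `γ_r, σ_r` per root, with
`lim β⁰(r, c⃗; cB, Tc) = γ_r + Φ(c⃗) + cB·σ_r + Λ(Tc)` on the WHOLE family; GEN 10's `D1PinnedSecondOrderModular` ∕ `…SecondOrderUniversal` ∕ `…TableResponseUniversal` ∕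
`…ColourResponseUniversal` ∕ `…PositionTableAffine` + GEN 12's `D1PinnedResponseTowers.lim_border_affine`, combined by `linear_combination`).
§3 **`secondMoment_eq_eval_mvPolynomial`** ∕ `secondMoment_levelSet_all_or_interior_empty`: SCALE BY SCALE and OFF the pin (any `1 ≤ Lc`, any weight `cE₂`, every level `j`) the STEP
coefficient `β⁰_j(c⃗)` is already one real polynomial of total degree ≤ 4 without linear part — a falsifiable identity for any engine tabulating `β⁰_j`.
READING: (D1) at the pinned literal, as a condition on print's UNCOMPUTED first-order colour triple, border weight and position table, is ONE real polynomial equation of total degree ≤ 4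
(quartic without linear part in the colours, affine in `cB`, linear in `Tc`); deciding it is a finite computation of real numbers (≤ 31 + 256 universal + 2 per root), none computed here.

Provenance: cell pub-balaban-gaps, seat g1-p1 GEN 13 (prover-pub-balaban-gaps-g1-p1-g13-0), 2026-08-24.  HONEST FRAMING: [folklore] kernel algebra BY NAME over tree theorems;
NOTHING of Bałaban's asserted ([Balaban1987RG1] Thm 2 is UNPROVED IN PRINT); NO coefficient computed or signed; which member is print's ((P6)) NOT decided; binder (D1) of B12 Thm 2
at the β-lead's pinned literal is NOT discharged; NOT `BetaPertH`, NOT continuum, NOT Clay.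
-/

noncomputable section

open Finset
open scoped BigOperators

namespace Summit.QuantumFields.BalabanUV.Gaps.D1PinnedColourPolynomial

open Summit.QuantumFields.BalabanUV.Gaps.D1PinnedColourPolynomialAlgebra (exists_mvPolynomial_deg_le_four interior_zeroSet_eq_empty isClosed_zeroSet)

section Pinned

open Literature.MathematicalPhysics.QuantumFieldTheory Balaban1983to89 Balaban1983to89.Beta
open OneStepKernelFamily (TbalOf D1Drift)
open AffineAveraging (box)
open RateCertificate (CauchyRate)
open Summit.QuantumFields.BalabanUV.Beta.MixedJetTablesPlug (JsBalAn1 JsBalAn1Ctr)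
open AveragingContoursRooted (ctrOff ctrOff_mem_box)
open Summit.QuantumFields.BalabanUV.Beta.GAN24.StencilSlotOfE3 (one_le_of_two_le)
open Summit.QuantumFields.BalabanUV.Gaps.CapTailPinnedLimitSign (d1Drift_pinned_iff_lim_eq)
open Summit.QuantumFields.BalabanUV.Gaps.D1PinnedColourRayReadings (lim_ray_fourMembers secondMoment_JsBalAn1_ray_nodes)
open Summit.QuantumFields.BalabanUV.Gaps.D1PinnedColourLineReadings (lim_line_fiveMembers secondMoment_JsBalAn1_line_nodes)
open Summit.QuantumFields.BalabanUV.Gaps.D1PinnedResponseTowers (lim_border_affine)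
open Summit.QuantumFields.BalabanUV.Gaps.D1PinnedSecondOrderModular (lim_JsBalAn1_secondOrder_modular)
open Summit.QuantumFields.BalabanUV.Gaps.D1PinnedSecondOrderUniversal (lim_JsBalAn1_response_universal)
open Summit.QuantumFields.BalabanUV.Gaps.D1PinnedTableResponseUniversal (lim_JsBalAn1_tableResponse_universal)
open Summit.QuantumFields.BalabanUV.Gaps.D1PinnedPositionTableAffine (lim_JsBalAn1_table_add lim_JsBalAn1_table_smul)
open Summit.QuantumFields.BalabanUV.Gaps.D1PinnedColourResponseUniversal (colourResponse_universal)

variable {Lc : ℕ} [NeZero Lc] {r : Fin (3 + 1) → ℕ}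

/-- [folklore] **THE COLOUR MAP OF THE PINNED FAMILY IS ONE REAL POLYNOMIAL OF TOTAL DEGREE ≤ 4 WITHOUT LINEAR PART** (hypothesis-free at the pin; any root, `cB`, `Tc`, channel):
there is `P : MvPolynomial (Fin 3) ℝ` with `P.totalDegree ≤ 4`, `P.homogeneousComponent 1 = 0`, `P.coeff 0 = lim β⁰(r,0⃗;cB,Tc)` and `lim β⁰(r,(cE,cVH,cΛ);cB,Tc) = P(cE,cVH,cΛ)` for
every colour triple (tensor Lagrange from `lim_line_fiveMembers`, degree trimmed by `lim_ray_fourMembers`; `P` is unique by `mvPolynomial_unique`). -/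
theorem lim_eq_eval_mvPolynomial (hLc : 2 ≤ Lc) (hr : r ∈ box (3 + 1) Lc) (cB : ℝ) (Tc : Fin 4 → Fin 4 → Fin 4 → Fin 4 → ℝ) (μ ν : Fin 4) :
    ∃ P : MvPolynomial (Fin 3) ℝ, P.totalDegree ≤ 4 ∧ P.homogeneousComponent 1 = 0 ∧
      P.coeff 0 = CauchyRate.lim (fun j => B12Beta.secondMoment (TbalOf Lc (JsBalAn1 (one_le_of_two_le hLc) hr 0 0 0 ((Lc : ℝ) ^ (2 * (3 + 1))) cB Tc) j) μ ν) ∧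
      ∀ cE cVH cΛ : ℝ, CauchyRate.lim (fun j => B12Beta.secondMoment (TbalOf Lc (JsBalAn1 (one_le_of_two_le hLc) hr cE cVH cΛ ((Lc : ℝ) ^ (2 * (3 + 1))) cB Tc) j) μ ν) =
        MvPolynomial.eval ![cE, cVH, cΛ] P :=
  exists_mvPolynomial_deg_le_four
    (fun cE cVH cΛ => CauchyRate.lim (fun j => B12Beta.secondMoment (TbalOf Lc (JsBalAn1 (one_le_of_two_le hLc) hr cE cVH cΛ ((Lc : ℝ) ^ (2 * (3 + 1))) cB Tc) j) μ ν))
    (fun cE₀ cVH₀ cΛ₀ cE₁ cVH₁ cΛ₁ t => lim_line_fiveMembers hLc hr cE₀ cVH₀ cΛ₀ cE₁ cVH₁ cΛ₁ cB Tc μ ν t)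
    (fun cE cVH cΛ t => lim_ray_fourMembers hLc hr cE cVH cΛ cB Tc μ ν t)

/-- [folklore] **(D1) AT THE PINNED LITERAL IS A POLYNOMIAL EQUATION OF DEGREE ≤ 4 IN PRINT'S COLOUR TRIPLE** (fixed root, `cB`, `Tc`, channel; every numeral `N`):
(D1) at the member `(cE,cVH,cΛ)` ⟺ `P(cE,cVH,cΛ) = stepBal N Lc`, with the polynomial `P` of `lim_eq_eval_mvPolynomial` (`CapTailPinnedLimitSign.d1Drift_pinned_iff_lim_eq`). -/
theorem d1Drift_iff_eval_eq_stepBal (hLc : 2 ≤ Lc) (hr : r ∈ box (3 + 1) Lc) (cB : ℝ) (Tc : Fin 4 → Fin 4 → Fin 4 → Fin 4 → ℝ) (μ ν : Fin 4) :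
    ∃ P : MvPolynomial (Fin 3) ℝ, P.totalDegree ≤ 4 ∧ P.homogeneousComponent 1 = 0 ∧
      ∀ (N cE cVH cΛ : ℝ), (D1Drift Lc (JsBalAn1 (one_le_of_two_le hLc) hr cE cVH cΛ ((Lc : ℝ) ^ (2 * (3 + 1))) cB Tc) N μ ν ↔
        MvPolynomial.eval ![cE, cVH, cΛ] P = B12Normalization.stepBal N Lc) := by
  obtain ⟨P, h4, h1, -, hP⟩ := lim_eq_eval_mvPolynomial hLc hr cB Tc μ ν
  exact ⟨P, h4, h1, fun N cE cVH cΛ => by rw [d1Drift_pinned_iff_lim_eq hLc hr, hP]⟩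

/-- [folklore] **ALL COLOUR TRIPLES, OR A PROPER ALGEBRAIC SET OF DEGREE ≤ 4** (fixed root, `cB`, `Tc`, numeral, channel; hypothesis-free at the pin): either (D1) holds at EVERY
colour triple of the pinned family, or the colour triples at which (D1) holds form the real zero set of a NONZERO polynomial of total degree `≤ 4` (which member is print's, and
which alternative holds, are print's UNCOMPUTED data). -/
theorem d1Drift_allColours_or_properAlgebraic (hLc : 2 ≤ Lc) (hr : r ∈ box (3 + 1) Lc) (cB : ℝ) (Tc : Fin 4 → Fin 4 → Fin 4 → Fin 4 → ℝ) (μ ν : Fin 4) (N : ℝ) :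
    (∀ cE cVH cΛ : ℝ, D1Drift Lc (JsBalAn1 (one_le_of_two_le hLc) hr cE cVH cΛ ((Lc : ℝ) ^ (2 * (3 + 1))) cB Tc) N μ ν) ∨
      ∃ Q : MvPolynomial (Fin 3) ℝ, Q ≠ 0 ∧ Q.totalDegree ≤ 4 ∧
        ∀ cE cVH cΛ : ℝ, (D1Drift Lc (JsBalAn1 (one_le_of_two_le hLc) hr cE cVH cΛ ((Lc : ℝ) ^ (2 * (3 + 1))) cB Tc) N μ ν ↔
          MvPolynomial.eval ![cE, cVH, cΛ] Q = 0) := by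
  obtain ⟨P, h4, -, hP⟩ := d1Drift_iff_eval_eq_stepBal hLc hr cB Tc μ ν
  have hQ : ∀ cE cVH cΛ : ℝ, (D1Drift Lc (JsBalAn1 (one_le_of_two_le hLc) hr cE cVH cΛ ((Lc : ℝ) ^ (2 * (3 + 1))) cB Tc) N μ ν ↔
      MvPolynomial.eval ![cE, cVH, cΛ] (P - MvPolynomial.C (B12Normalization.stepBal N Lc)) = 0) := fun cE cVH cΛ => by
    rw [hP N, map_sub, MvPolynomial.eval_C, sub_eq_zero]
  by_cases hz : P - MvPolynomial.C (B12Normalization.stepBal N Lc) = 0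
  · exact Or.inl fun cE cVH cΛ => (hQ cE cVH cΛ).mpr (by rw [hz, map_zero])
  · refine Or.inr ⟨_, hz, (MvPolynomial.totalDegree_sub _ _).trans (max_le h4 ?_), hQ⟩
    rw [MvPolynomial.totalDegree_C]; exact Nat.zero_le _

/-- [folklore] **(D1) AT THE PINNED LITERAL IS NOT AN OPEN CONDITION ON THE COLOURS UNLESS IT IS AUTOMATIC** (fixed root, `cB`, `Tc`, numeral, channel; hypothesis-free at the
pin): either (D1) holds at EVERY colour triple, or the set of colour triples `c : Fin 3 → ℝ` at which (D1) holds is CLOSED with EMPTY INTERIOR in ℝ³ (an arbitrarily small change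
of print's colour triple can destroy it; `interior_zeroSet_eq_empty`). -/
theorem d1Drift_allColours_or_interior_empty (hLc : 2 ≤ Lc) (hr : r ∈ box (3 + 1) Lc) (cB : ℝ) (Tc : Fin 4 → Fin 4 → Fin 4 → Fin 4 → ℝ) (μ ν : Fin 4) (N : ℝ) :
    (∀ cE cVH cΛ : ℝ, D1Drift Lc (JsBalAn1 (one_le_of_two_le hLc) hr cE cVH cΛ ((Lc : ℝ) ^ (2 * (3 + 1))) cB Tc) N μ ν) ∨
      (IsClosed {c : Fin 3 → ℝ | D1Drift Lc (JsBalAn1 (one_le_of_two_le hLc) hr (c 0) (c 1) (c 2) ((Lc : ℝ) ^ (2 * (3 + 1))) cB Tc) N μ ν} ∧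
        interior {c : Fin 3 → ℝ | D1Drift Lc (JsBalAn1 (one_le_of_two_le hLc) hr (c 0) (c 1) (c 2) ((Lc : ℝ) ^ (2 * (3 + 1))) cB Tc) N μ ν} = ∅) := by
  rcases d1Drift_allColours_or_properAlgebraic hLc hr cB Tc μ ν N with h | ⟨Q, hQ, -, hiff⟩
  · exact Or.inl h
  · have hset : {c : Fin 3 → ℝ | D1Drift Lc (JsBalAn1 (one_le_of_two_le hLc) hr (c 0) (c 1) (c 2) ((Lc : ℝ) ^ (2 * (3 + 1))) cB Tc) N μ ν} =
        {c : Fin 3 → ℝ | MvPolynomial.eval c Q = 0} := by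
      ext c
      have hc : ![c 0, c 1, c 2] = c := by ext i; fin_cases i <;> rfl
      rw [Set.mem_setOf_eq, Set.mem_setOf_eq, hiff, hc]
    rw [hset]
    exact Or.inr ⟨isClosed_zeroSet Q, interior_zeroSet_eq_empty hQ⟩

/-- [folklore] **THE POLYNOMIAL NORMAL FORM ON THE WHOLE PINNED FAMILY** (hypothesis-free at the pin; fixed root and channel): there are ONE polynomial `P` (total degree `≤ 4`, no
linear part), ONE real number `σ` (the border slope) and ONE `ℝ`-linear functional `Λ` of the position table such that `lim β⁰(r,c⃗;cB,Tc) = P(c⃗) + cB·σ + Λ(Tc)` for EVERY member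
(GEN 10's four pieces — `D1PinnedSecondOrderModular`, `D1PinnedResponseTowers.lim_border_affine`, `D1PinnedSecondOrderUniversal`, `D1PinnedTableResponseUniversal`,
`D1PinnedPositionTableAffine` — with the colour piece `γ(r) + φ` now the polynomial `P`). -/
theorem lim_normalForm_polynomial (hLc : 2 ≤ Lc) (hr : r ∈ box (3 + 1) Lc) (μ ν : Fin 4) :
    ∃ (P : MvPolynomial (Fin 3) ℝ) (σ : ℝ) (Λ : (Fin 4 → Fin 4 → Fin 4 → Fin 4 → ℝ) →ₗ[ℝ] ℝ), P.totalDegree ≤ 4 ∧ P.homogeneousComponent 1 = 0 ∧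
      ∀ (cE cVH cΛ cB : ℝ) (Tc : Fin 4 → Fin 4 → Fin 4 → Fin 4 → ℝ),
        CauchyRate.lim (fun j => B12Beta.secondMoment (TbalOf Lc (JsBalAn1 (one_le_of_two_le hLc) hr cE cVH cΛ ((Lc : ℝ) ^ (2 * (3 + 1))) cB Tc) j) μ ν) =
          MvPolynomial.eval ![cE, cVH, cΛ] P + cB * σ + Λ Tc := by
  obtain ⟨P, h4, h1, -, hP⟩ := lim_eq_eval_mvPolynomial hLc hr 0 0 μ ν
  -- the table response at the colour-free, border-free member, as a linear functional
  set L : (Fin 4 → Fin 4 → Fin 4 → Fin 4 → ℝ) → ℝ := fun T =>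
    CauchyRate.lim (fun j => B12Beta.secondMoment (TbalOf Lc (JsBalAn1 (one_le_of_two_le hLc) hr 0 0 0 ((Lc : ℝ) ^ (2 * (3 + 1))) 0 T) j) μ ν) with hL
  have hadd : ∀ T₀ T₁, L (T₀ + T₁) + L 0 = L T₀ + L T₁ := fun T₀ T₁ => lim_JsBalAn1_table_add hLc hr 0 0 0 0 T₀ T₁ μ ν
  have hsmul : ∀ (s : ℝ) T, L (s • T) = (1 - s) * L 0 + s * L T := fun s T => lim_JsBalAn1_table_smul hLc hr 0 0 0 0 T s μ ν
  let Λ : (Fin 4 → Fin 4 → Fin 4 → Fin 4 → ℝ) →ₗ[ℝ] ℝ :=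
    { toFun := fun T => L T - L 0
      map_add' := fun T₀ T₁ => by linear_combination hadd T₀ T₁
      map_smul' := fun s T => by simp only [RingHom.id_apply, smul_eq_mul]; linear_combination hsmul s T }
  refine ⟨P, CauchyRate.lim (fun j => B12Beta.secondMoment (TbalOf Lc (JsBalAn1 (one_le_of_two_le hLc) hr 0 0 0 ((Lc : ℝ) ^ (2 * (3 + 1))) 1 0) j) μ ν) -
      CauchyRate.lim (fun j => B12Beta.secondMoment (TbalOf Lc (JsBalAn1 (one_le_of_two_le hLc) hr 0 0 0 ((Lc : ℝ) ^ (2 * (3 + 1))) 0 0) j) μ ν), Λ, h4, h1,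
    fun cE cVH cΛ cB Tc => ?_⟩
  have hmod := lim_JsBalAn1_secondOrder_modular hLc hr cE cVH cΛ cB Tc μ ν
  have haff := lim_border_affine hLc hr cE cVH cΛ cB 0 μ ν
  have hσ := lim_JsBalAn1_response_universal hLc hr cE cVH cΛ 0 0 0 1 0 μ ν
  have hlam := lim_JsBalAn1_tableResponse_universal hLc hr hr cE cVH cΛ 0 0 0 0 0 Tc μ ν
  have hA := hP cE cVH cΛ
  show _ = _ + _ + (L Tc - L 0)
  simp only [hL]
  linear_combination hmod + haff + cB * hσ + hlam + hA

/-- [folklore] **(D1) ON THE WHOLE PINNED FAMILY IS ONE POLYNOMIAL EQUATION** (fixed root and channel; every numeral): with `P, σ, Λ` of `lim_normalForm_polynomial`,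
(D1) at `(c⃗; cB; Tc)` ⟺ `P(c⃗) + cB·σ + Λ(Tc) = stepBal N Lc` — quartic without linear part in the colours, affine in the border weight, linear in the position table. -/
theorem d1Drift_iff_normalForm_polynomial (hLc : 2 ≤ Lc) (hr : r ∈ box (3 + 1) Lc) (μ ν : Fin 4) :
    ∃ (P : MvPolynomial (Fin 3) ℝ) (σ : ℝ) (Λ : (Fin 4 → Fin 4 → Fin 4 → Fin 4 → ℝ) →ₗ[ℝ] ℝ), P.totalDegree ≤ 4 ∧ P.homogeneousComponent 1 = 0 ∧
      ∀ (N cE cVH cΛ cB : ℝ) (Tc : Fin 4 → Fin 4 → Fin 4 → Fin 4 → ℝ),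
        (D1Drift Lc (JsBalAn1 (one_le_of_two_le hLc) hr cE cVH cΛ ((Lc : ℝ) ^ (2 * (3 + 1))) cB Tc) N μ ν ↔
          MvPolynomial.eval ![cE, cVH, cΛ] P + cB * σ + Λ Tc = B12Normalization.stepBal N Lc) := by
  obtain ⟨P, σ, Λ, h4, h1, h⟩ := lim_normalForm_polynomial hLc hr μ ν
  exact ⟨P, σ, Λ, h4, h1, fun N cE cVH cΛ cB Tc => by rw [d1Drift_pinned_iff_lim_eq hLc hr, h]⟩

/-- [folklore] **THE UNIVERSAL POLYNOMIAL NORMAL FORM** (hypothesis-free at the pin; fixed channel; `r₀` any reference root): there are ONE polynomial `Φ ∈ ℝ[X₀,X₁,X₂]` with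
`Φ.totalDegree ≤ 4`, NO constant and NO linear part, and ONE `ℝ`-linear functional `Λ` of the position table — BOTH FREE OF THE ROOT — such that for EVERY box root `r` there are two
real numbers `γ_r` (base value) and `σ_r` (border slope) with `lim β⁰(r, c⃗; cB, Tc) = γ_r + Φ(c⃗) + cB·σ_r + Λ(Tc)` for every colour triple, border weight and table
(`lim_normalForm_polynomial` + the root-universality of the colour response `D1PinnedColourResponseUniversal.colourResponse_universal` and of the table response
`D1PinnedTableResponseUniversal`).  So (D1) on the whole pinned family, at all roots, is governed by `Φ` (≤ 31 coefficients), `Λ` (256), and two numbers per root — none computed here. -/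
theorem lim_normalForm_universal (hLc : 2 ≤ Lc) {r₀ : Fin (3 + 1) → ℕ} (hr₀ : r₀ ∈ box (3 + 1) Lc) (μ ν : Fin 4) :
    ∃ (Φ : MvPolynomial (Fin 3) ℝ) (Λ : (Fin 4 → Fin 4 → Fin 4 → Fin 4 → ℝ) →ₗ[ℝ] ℝ),
      Φ.totalDegree ≤ 4 ∧ Φ.homogeneousComponent 1 = 0 ∧ Φ.coeff 0 = 0 ∧
      ∀ (r : Fin (3 + 1) → ℕ) (hr : r ∈ box (3 + 1) Lc), ∃ γ σ : ℝ, ∀ (cE cVH cΛ cB : ℝ) (Tc : Fin 4 → Fin 4 → Fin 4 → Fin 4 → ℝ),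
        CauchyRate.lim (fun j => B12Beta.secondMoment (TbalOf Lc (JsBalAn1 (one_le_of_two_le hLc) hr cE cVH cΛ ((Lc : ℝ) ^ (2 * (3 + 1))) cB Tc) j) μ ν) =
          γ + MvPolynomial.eval ![cE, cVH, cΛ] Φ + cB * σ + Λ Tc := by
  obtain ⟨P₀, h4, h1, h00, hP₀⟩ := lim_eq_eval_mvPolynomial hLc hr₀ 0 0 μ ν
  -- the table response at the reference root's colour-free, border-free member, as a linear functional
  set L : (Fin 4 → Fin 4 → Fin 4 → Fin 4 → ℝ) → ℝ := fun T =>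
    CauchyRate.lim (fun j => B12Beta.secondMoment (TbalOf Lc (JsBalAn1 (one_le_of_two_le hLc) hr₀ 0 0 0 ((Lc : ℝ) ^ (2 * (3 + 1))) 0 T) j) μ ν) with hL
  have hadd : ∀ T₀ T₁, L (T₀ + T₁) + L 0 = L T₀ + L T₁ := fun T₀ T₁ => lim_JsBalAn1_table_add hLc hr₀ 0 0 0 0 T₀ T₁ μ ν
  have hsmul : ∀ (s : ℝ) T, L (s • T) = (1 - s) * L 0 + s * L T := fun s T => lim_JsBalAn1_table_smul hLc hr₀ 0 0 0 0 T s μ ν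
  let Λ : (Fin 4 → Fin 4 → Fin 4 → Fin 4 → ℝ) →ₗ[ℝ] ℝ :=
    { toFun := fun T => L T - L 0
      map_add' := fun T₀ T₁ => by linear_combination hadd T₀ T₁
      map_smul' := fun s T => by simp only [RingHom.id_apply, smul_eq_mul]; linear_combination hsmul s T }
  refine ⟨P₀ - MvPolynomial.C (P₀.coeff 0), Λ, (MvPolynomial.totalDegree_sub _ _).trans (max_le h4 (by rw [MvPolynomial.totalDegree_C]; exact Nat.zero_le _)), ?_, ?_,
    fun r hr => ?_⟩
  · rw [map_sub, h1, zero_sub, neg_eq_zero, MvPolynomial.homogeneousComponent_eq_zero _ _ (by rw [MvPolynomial.totalDegree_C]; exact Nat.zero_lt_one)]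
  · rw [MvPolynomial.coeff_sub, MvPolynomial.coeff_zero_C, sub_self]
  refine ⟨CauchyRate.lim (fun j => B12Beta.secondMoment (TbalOf Lc (JsBalAn1 (one_le_of_two_le hLc) hr 0 0 0 ((Lc : ℝ) ^ (2 * (3 + 1))) 0 0) j) μ ν),
    CauchyRate.lim (fun j => B12Beta.secondMoment (TbalOf Lc (JsBalAn1 (one_le_of_two_le hLc) hr 0 0 0 ((Lc : ℝ) ^ (2 * (3 + 1))) 1 0) j) μ ν) -
      CauchyRate.lim (fun j => B12Beta.secondMoment (TbalOf Lc (JsBalAn1 (one_le_of_two_le hLc) hr 0 0 0 ((Lc : ℝ) ^ (2 * (3 + 1))) 0 0) j) μ ν),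
    fun cE cVH cΛ cB Tc => ?_⟩
  have hmod := lim_JsBalAn1_secondOrder_modular hLc hr cE cVH cΛ cB Tc μ ν
  have haff := lim_border_affine hLc hr cE cVH cΛ cB 0 μ ν
  have hσ := lim_JsBalAn1_response_universal hLc hr cE cVH cΛ 0 0 0 1 0 μ ν
  have hlam := lim_JsBalAn1_tableResponse_universal hLc hr hr₀ cE cVH cΛ 0 0 0 0 0 Tc μ ν
  have hcol := colourResponse_universal hLc hr hr₀ cE cVH cΛ 0 0 0 0 0 0 0 μ ν
  have hA := hP₀ cE cVH cΛ
  show _ = _ + _ + _ + (L Tc - L 0)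
  simp only [hL, map_sub, MvPolynomial.eval_C]
  linear_combination hmod + haff + cB * hσ + hlam + hcol + hA + h00

/-- [folklore] **THE UNIVERSAL NORMAL FORM WITH THE TARGETS PAGE's PIECES BY NAME** (hypothesis-free at the pin; `r₀` a reference root): with the SAME root-free quartic `Φ`,
for every root `r` and every member, `lim β⁰(r,c⃗;cB,Tc) = γ(r) + Φ(c⃗) + cB·σ(r) + λ(Tc)` where **`γ(r) = lim β⁰(r,0⃗;0,0)`** (target T3), **`σ(r) = lim β⁰(r,0⃗;1,0) − lim β⁰(r,0⃗;0,0)`**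
(target T1 — the border tower's limit, `D1PinnedResponseTowers.borderSlope_eq_lim_tower`) and **`λ(Tc) = lim β⁰(r₀,0⃗;0,Tc) − lim β⁰(r₀,0⃗;0,0)`** (target T2 — the table tower's limit,
`tableResponse_eq_lim_tower`, root-free). -/
theorem lim_normalForm_targets (hLc : 2 ≤ Lc) {r₀ : Fin (3 + 1) → ℕ} (hr₀ : r₀ ∈ box (3 + 1) Lc) (μ ν : Fin 4) :
    ∃ Φ : MvPolynomial (Fin 3) ℝ, Φ.totalDegree ≤ 4 ∧ Φ.homogeneousComponent 1 = 0 ∧ Φ.coeff 0 = 0 ∧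
      ∀ (r : Fin (3 + 1) → ℕ) (hr : r ∈ box (3 + 1) Lc) (cE cVH cΛ cB : ℝ) (Tc : Fin 4 → Fin 4 → Fin 4 → Fin 4 → ℝ),
        CauchyRate.lim (fun j => B12Beta.secondMoment (TbalOf Lc (JsBalAn1 (one_le_of_two_le hLc) hr cE cVH cΛ ((Lc : ℝ) ^ (2 * (3 + 1))) cB Tc) j) μ ν) =
          CauchyRate.lim (fun j => B12Beta.secondMoment (TbalOf Lc (JsBalAn1 (one_le_of_two_le hLc) hr 0 0 0 ((Lc : ℝ) ^ (2 * (3 + 1))) 0 0) j) μ ν) +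
            MvPolynomial.eval ![cE, cVH, cΛ] Φ +
            cB * (CauchyRate.lim (fun j => B12Beta.secondMoment (TbalOf Lc (JsBalAn1 (one_le_of_two_le hLc) hr 0 0 0 ((Lc : ℝ) ^ (2 * (3 + 1))) 1 0) j) μ ν) -
              CauchyRate.lim (fun j => B12Beta.secondMoment (TbalOf Lc (JsBalAn1 (one_le_of_two_le hLc) hr 0 0 0 ((Lc : ℝ) ^ (2 * (3 + 1))) 0 0) j) μ ν)) +
            (CauchyRate.lim (fun j => B12Beta.secondMoment (TbalOf Lc (JsBalAn1 (one_le_of_two_le hLc) hr₀ 0 0 0 ((Lc : ℝ) ^ (2 * (3 + 1))) 0 Tc) j) μ ν) -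
              CauchyRate.lim (fun j => B12Beta.secondMoment (TbalOf Lc (JsBalAn1 (one_le_of_two_le hLc) hr₀ 0 0 0 ((Lc : ℝ) ^ (2 * (3 + 1))) 0 0) j) μ ν)) := by
  obtain ⟨P₀, h4, h1, h00, hP₀⟩ := lim_eq_eval_mvPolynomial hLc hr₀ 0 0 μ ν
  refine ⟨P₀ - MvPolynomial.C (P₀.coeff 0), (MvPolynomial.totalDegree_sub _ _).trans (max_le h4 (by rw [MvPolynomial.totalDegree_C]; exact Nat.zero_le _)), ?_, ?_,
    fun r hr cE cVH cΛ cB Tc => ?_⟩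
  · rw [map_sub, h1, zero_sub, neg_eq_zero, MvPolynomial.homogeneousComponent_eq_zero _ _ (by rw [MvPolynomial.totalDegree_C]; exact Nat.zero_lt_one)]
  · rw [MvPolynomial.coeff_sub, MvPolynomial.coeff_zero_C, sub_self]
  have hmod := lim_JsBalAn1_secondOrder_modular hLc hr cE cVH cΛ cB Tc μ ν
  have haff := lim_border_affine hLc hr cE cVH cΛ cB 0 μ ν
  have hσ := lim_JsBalAn1_response_universal hLc hr cE cVH cΛ 0 0 0 1 0 μ ν
  have hlam := lim_JsBalAn1_tableResponse_universal hLc hr hr₀ cE cVH cΛ 0 0 0 0 0 Tc μ ν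
  have hcol := colourResponse_universal hLc hr hr₀ cE cVH cΛ 0 0 0 0 0 0 0 μ ν
  have hA := hP₀ cE cVH cΛ
  simp only [map_sub, MvPolynomial.eval_C]
  linear_combination hmod + haff + cB * hσ + hlam + hcol + hA + h00

/-- [folklore] **(D1) ON THE WHOLE PINNED FAMILY, ALL ROOTS: ONE UNIVERSAL QUARTIC, ONE UNIVERSAL LINEAR FUNCTIONAL, TWO NUMBERS PER ROOT** (fixed channel; every numeral): with
`Φ, Λ` of `lim_normalForm_universal` and the root's `γ_r, σ_r`, (D1) at `(r; c⃗; cB; Tc)` ⟺ `γ_r + Φ(c⃗) + cB·σ_r + Λ(Tc) = stepBal N Lc`. -/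
theorem d1Drift_iff_normalForm_universal (hLc : 2 ≤ Lc) {r₀ : Fin (3 + 1) → ℕ} (hr₀ : r₀ ∈ box (3 + 1) Lc) (μ ν : Fin 4) :
    ∃ (Φ : MvPolynomial (Fin 3) ℝ) (Λ : (Fin 4 → Fin 4 → Fin 4 → Fin 4 → ℝ) →ₗ[ℝ] ℝ),
      Φ.totalDegree ≤ 4 ∧ Φ.homogeneousComponent 1 = 0 ∧ Φ.coeff 0 = 0 ∧
      ∀ (r : Fin (3 + 1) → ℕ) (hr : r ∈ box (3 + 1) Lc), ∃ γ σ : ℝ, ∀ (N cE cVH cΛ cB : ℝ) (Tc : Fin 4 → Fin 4 → Fin 4 → Fin 4 → ℝ),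
        (D1Drift Lc (JsBalAn1 (one_le_of_two_le hLc) hr cE cVH cΛ ((Lc : ℝ) ^ (2 * (3 + 1))) cB Tc) N μ ν ↔
          γ + MvPolynomial.eval ![cE, cVH, cΛ] Φ + cB * σ + Λ Tc = B12Normalization.stepBal N Lc) := by
  obtain ⟨Φ, Λ, h4, h1, h0, h⟩ := lim_normalForm_universal hLc hr₀ μ ν
  refine ⟨Φ, Λ, h4, h1, h0, fun r hr => ?_⟩
  obtain ⟨γ, σ, hγ⟩ := h r hr
  exact ⟨γ, σ, fun N cE cVH cΛ cB Tc => by rw [d1Drift_pinned_iff_lim_eq hLc hr, hγ]⟩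

/-- [folklore] **AT THE CENTRED LITERAL `JsBalAn1Ctr`** (road BF-x's ∕ `D1PinnedLimitClosedForm`'s centred member; `JsBalAn1Ctr = JsBalAn1 … (ctrOff_mem_box …)` by `rfl`): with the
universal root-free `Φ, Λ` (reference root = the centre) and the centre's two numbers `γ, σ`, (D1) at `JsBalAn1Ctr(cE cVH cΛ; Lc^8; cB; Tc)` ⟺ `γ + Φ(c⃗) + cB·σ + Λ(Tc) = stepBal N Lc`. -/
theorem d1Drift_ctr_iff_normalForm (hLc : 2 ≤ Lc) (μ ν : Fin 4) :
    ∃ (Φ : MvPolynomial (Fin 3) ℝ) (Λ : (Fin 4 → Fin 4 → Fin 4 → Fin 4 → ℝ) →ₗ[ℝ] ℝ) (γ σ : ℝ),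
      Φ.totalDegree ≤ 4 ∧ Φ.homogeneousComponent 1 = 0 ∧ Φ.coeff 0 = 0 ∧
      ∀ (N cE cVH cΛ cB : ℝ) (Tc : Fin 4 → Fin 4 → Fin 4 → Fin 4 → ℝ),
        (D1Drift Lc (JsBalAn1Ctr (one_le_of_two_le hLc) cE cVH cΛ ((Lc : ℝ) ^ (2 * (3 + 1))) cB Tc) N μ ν ↔
          γ + MvPolynomial.eval ![cE, cVH, cΛ] Φ + cB * σ + Λ Tc = B12Normalization.stepBal N Lc) := by
  obtain ⟨Φ, Λ, h4, h1, h0, h⟩ := d1Drift_iff_normalForm_universal hLc (ctrOff_mem_box (d := 3 + 1) (one_le_of_two_le hLc)) μ ν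
  obtain ⟨γ, σ, hγ⟩ := h (ctrOff (3 + 1) Lc) (ctrOff_mem_box (one_le_of_two_le hLc))
  exact ⟨Φ, Λ, γ, σ, h4, h1, h0, fun N cE cVH cΛ cB Tc => hγ N cE cVH cΛ cB Tc⟩

/-! ## §3 Scale by scale and OFF the pin: every one-loop STEP coefficient `β⁰_j` is a polynomial of total degree ≤ 4 in the colour triple (any `1 ≤ Lc`, any weight `cE₂`) -/

/-- [folklore] **SCALE BY SCALE, OFF THE PIN: `β⁰_j(c⃗) = secondMoment (TbalOf Lc (JsBalAn1 r c⃗ cE₂ cB T) j) μ ν` IS ONE REAL POLYNOMIAL OF TOTAL DEGREE ≤ 4 IN THE COLOUR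
TRIPLE WITHOUT LINEAR PART** — for EVERY level `j`, every `1 ≤ Lc`, every weight `cE₂`, border weight `cB`, table `T`, root and channel (the five-node LINE law
`D1PinnedColourLineReadings.secondMoment_JsBalAn1_line_nodes` at the Lagrange nodes `0,…,4` + the RAY law `D1PinnedColourRayReadings.secondMoment_JsBalAn1_ray_nodes` at the nodes
`0,1,2,3`, then `D1PinnedColourPolynomialAlgebra.exists_mvPolynomial_deg_le_four`); a falsifiable identity for any engine tabulating `β⁰_j` at finitely many colour triples. -/
theorem secondMoment_eq_eval_mvPolynomial (hLc : 1 ≤ Lc) (hr : r ∈ box (3 + 1) Lc) (cE₂ cB : ℝ) (T : Fin 4 → Fin 4 → Fin 4 → Fin 4 → ℝ) (j : ℕ) (μ ν : Fin 4) :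
    ∃ P : MvPolynomial (Fin 3) ℝ, P.totalDegree ≤ 4 ∧ P.homogeneousComponent 1 = 0 ∧
      P.coeff 0 = B12Beta.secondMoment (TbalOf Lc (JsBalAn1 hLc hr 0 0 0 cE₂ cB T) j) μ ν ∧
      ∀ cE cVH cΛ : ℝ, B12Beta.secondMoment (TbalOf Lc (JsBalAn1 hLc hr cE cVH cΛ cE₂ cB T) j) μ ν = MvPolynomial.eval ![cE, cVH, cΛ] P := by
  refine exists_mvPolynomial_deg_le_four (fun cE cVH cΛ => B12Beta.secondMoment (TbalOf Lc (JsBalAn1 hLc hr cE cVH cΛ cE₂ cB T) j) μ ν)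
    (fun cE₀ cVH₀ cΛ₀ cE₁ cVH₁ cΛ₁ t => ?_) (fun cE cVH cΛ t => ?_)
  · have h := secondMoment_JsBalAn1_line_nodes hLc hr cE₀ cVH₀ cΛ₀ cE₁ cVH₁ cΛ₁ cE₂ cB T j t 0 1 2 3 4 ((t - 1) * (t - 2) * (t - 3) * (t - 4) / 24)
      (-(t * (t - 2) * (t - 3) * (t - 4) / 6)) (t * (t - 1) * (t - 3) * (t - 4) / 4) (-(t * (t - 1) * (t - 2) * (t - 4) / 6)) (t * (t - 1) * (t - 2) * (t - 3) / 24)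
      (by ring) (by ring) (by ring) (by ring) (by ring) μ ν
    simp only [zero_mul, one_mul, add_zero] at h
    exact h
  · have h := secondMoment_JsBalAn1_ray_nodes hLc hr cE cVH cΛ cE₂ cB T j t 0 1 2 3 0
      (1 - t ^ 2 * (t - 2) * (t - 3) / 2 + t ^ 2 * (t - 1) * (t - 3) / 4 - t ^ 2 * (t - 1) * (t - 2) / 18) (t ^ 2 * (t - 2) * (t - 3) / 2)
      (-(t ^ 2 * (t - 1) * (t - 3) / 4)) (t ^ 2 * (t - 1) * (t - 2) / 18) 0 (by ring) (by ring) (by ring) (by ring) μ ν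
    simp only [zero_mul, one_mul, add_zero] at h
    exact h

/-- [folklore] **SCALE BY SCALE: ALL COLOUR TRIPLES OR A CLOSED SET WITH EMPTY INTERIOR** — for every level `j` (any `1 ≤ Lc`, `cE₂`, `cB`, `T`, root, channel) and every real `v`,
either `β⁰_j(c⃗) = v` for EVERY colour triple or `{c⃗ ∣ β⁰_j(c⃗) = v}` is closed with empty interior in ℝ³. -/
theorem secondMoment_levelSet_all_or_interior_empty (hLc : 1 ≤ Lc) (hr : r ∈ box (3 + 1) Lc) (cE₂ cB : ℝ) (T : Fin 4 → Fin 4 → Fin 4 → Fin 4 → ℝ) (j : ℕ)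
    (μ ν : Fin 4) (v : ℝ) :
    (∀ cE cVH cΛ : ℝ, B12Beta.secondMoment (TbalOf Lc (JsBalAn1 hLc hr cE cVH cΛ cE₂ cB T) j) μ ν = v) ∨
      (IsClosed {c : Fin 3 → ℝ | B12Beta.secondMoment (TbalOf Lc (JsBalAn1 hLc hr (c 0) (c 1) (c 2) cE₂ cB T) j) μ ν = v} ∧
        interior {c : Fin 3 → ℝ | B12Beta.secondMoment (TbalOf Lc (JsBalAn1 hLc hr (c 0) (c 1) (c 2) cE₂ cB T) j) μ ν = v} = ∅) := by
  obtain ⟨P, -, -, -, hP⟩ := secondMoment_eq_eval_mvPolynomial hLc hr cE₂ cB T j μ ν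
  have hset : {c : Fin 3 → ℝ | B12Beta.secondMoment (TbalOf Lc (JsBalAn1 hLc hr (c 0) (c 1) (c 2) cE₂ cB T) j) μ ν = v} =
      {c : Fin 3 → ℝ | MvPolynomial.eval c (P - MvPolynomial.C v) = 0} := by
    ext c
    have hc : ![c 0, c 1, c 2] = c := by ext i; fin_cases i <;> rfl
    rw [Set.mem_setOf_eq, Set.mem_setOf_eq, hP, hc, map_sub, MvPolynomial.eval_C, sub_eq_zero]
  by_cases hz : P - MvPolynomial.C v = 0
  · refine Or.inl fun cE cVH cΛ => ?_
    rw [hP, ← sub_eq_zero, ← MvPolynomial.eval_C (f := ![cE, cVH, cΛ]) v, ← map_sub, hz, map_zero]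
  · rw [hset]
    exact Or.inr ⟨isClosed_zeroSet _, interior_zeroSet_eq_empty hz⟩

end Pinned

end Summit.QuantumFields.BalabanUV.Gaps.D1PinnedColourPolynomial

end
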